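import Literature.MathematicalPhysics.QuantumLattice.AnisotropicKLSIntegral
import Literature.Probability.LatticeModels.AnisotropicInfraredConstantBound
import HarnessLib

/-!
# The anisotropic KLS Riemann sum by Cauchy–Schwarz: `R^K_L ≤ [Σᵢ Kᵢ² · T^K_L/(2κ_K)]^{1/2}`, and
# long-range order for direction-dependent couplings from the infrared constant `C₀(K)` —
# unconditional for the layered quantum XY model of spin `S ≥ 1`

Topic `MathematicalPhysics/QuantumLattice`; a closing companion of `AnisotropicKLSIntegral.lean`.
The one numerical input of the anisotropic Kennedy–Lieb–Shastry chain for
`H_K = -Σ_xΣᵢ Kᵢ(S¹_xS¹_{x+eᵢ} + S²_xS²_{x+eᵢ})` (`AnisotropicXYLongRangeOrder.lean`) is an eventual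
bound `R^K_L ≤ ρ < S√2` on the punctured Riemann sums of `F_K = {C_K}₊[2/(κ_K E^K)]^{1/2}`.
By Cauchy–Schwarz on the dual torus,

`R^K_L = |Λ|⁻¹Σ_{q≠0}{C_K(q)}₊[2/(κ_K E^K_q)]^{1/2}`
`      ≤ [|Λ|⁻¹Σ_q {C_K(q)}₊²]^{1/2} [(2/κ_K)|Λ|⁻¹Σ_{q≠0} 1/E^K_q]^{1/2}`,

and `|Λ|⁻¹Σ_q {C_K(q)}₊² = ¼Σᵢ Kᵢ²` exactly on even tori of side `≥ 4` (orthogonality of the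
cosines, `Σ_q cos qᵢ cos qⱼ = ½|Λ|δᵢⱼ`, and the half-period shift `q ↦ q + (L/2,…,L/2)`, which flips
the sign of every `cos qᵢ`), so that `R^K_L ≤ [Σᵢ Kᵢ² T^K_L/(2κ_K)]^{1/2}` with the anisotropic
torus sum `T^K_L = |Λ|⁻¹Σ_{q≠0} 1/E^K_q` (`anisoKlsRiemannSum_le_sqrt`). In `d ≥ 3`, `T^K_L`
converges along the even sides to Fröhlich–Israel–Lieb–Simon's constant `C₀(K) = (2π)^{-d}∫dp/E^K_p`
(`AnisotropicRotator.infraredConstant`, `torusSum_inv_anisoDispersion_approx`, [FILS1978] (4.7)),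
whence ground-state and low-temperature long-range order of `H_K` as soon as
`Σᵢ Kᵢ² · C₀(K) < n² κ_K` (`S = n/2`; `xyAniso_longRangeOrder_ground_of_infraredConstant`,
`xyAniso_longRangeOrder_thermal_of_infraredConstant`). For the layered model `K = (1, 1, r)` of
[KLS1988JSP] §3 the constant is their `C(r) = (2π)⁻³∫d³q/E^r_q` (`AnisotropicRotator.klsConstant`)
and the condition reads `(2 + r²)C(r) < n²(2 + r)`; with the tree's bound
`C(r) ≤ 1 + π/4 + (π/8)log(1/r)` (`klsConstant_le_sharp`) this holds for every spin `S ≥ 1` and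
`1/100 ≤ r ≤ 1`, giving the **unconditional** theorem `xyLayered_longRangeOrder_spin_ge_one`; for
`S = ½` (hard-core bosons) it reduces the question to the single enclosure `(2 + r²)C(r) < 2 + r`
of a one-dimensional Bessel integral (`klsConstant_eq_integral`), e.g. `C(1) = 0.5055 < 1` (Watson).
No named fact; no definition.

## References

* [KLS1988PRL] T. Kennedy, E. H. Lieb, B. S. Shastry, Phys. Rev. Lett. 61 (1988) 2582–2584,
  eqs. (7)–(8).
* [KLS1988JSP] T. Kennedy, E. H. Lieb, B. S. Shastry, J. Stat. Phys. 53 (1988) 1019–1030, §3,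
  eqs. (5)–(9), p. 1020.
* [FILS1978] J. Fröhlich, R. Israel, E. H. Lieb, B. Simon, Commun. Math. Phys. 62 (1978) 1–34,
  (4.7)–(4.10).
* [DLS1978] F. J. Dyson, E. H. Lieb, B. Simon, J. Stat. Phys. 18 (1978) 335–383, Thm. 5.1.
-/

noncomputable section

open MeasureTheory Filter Topology Finset
open Literature.MathematicalPhysics.QuantumLattice Literature.Probability.LatticeModels
  Literature.MathematicalPhysics.QuantumLattice.XYOrderProofs
  Literature.Barriers.AtomisticToContinuum.BoseGas

namespace Literature.MathematicalPhysics.QuantumLattice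

variable {d : ℕ}

/-! ### Trigonometric sums on the dual torus -/

section TrigSums

variable (L : ℕ) [NeZero L]

/-- `cos(q · eᵢ) = cos qᵢ` for the phase of `XYOrderProofs`. [folklore] -/
private theorem cos_torusPhase_single (q : TorusSite d L) (i : Fin d) :
    Real.cos (torusPhase L q (Pi.single i 1)) = Real.cos (latticeMomentum L q i) := by
  rw [← torusChar_re, torusChar_single_re]

/-- **Orthogonality of the cosines on the dual torus** (`L ≥ 3`):
`Σ_q cos qᵢ cos qⱼ = ½|Λ| δᵢⱼ`. [cite: KLS1988PRL, eq. (6)] -/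
theorem sum_cos_mul_cos_latticeMomentum (hL3 : 3 ≤ L) (i j : Fin d) :
    ∑ q : TorusSite d L, Real.cos (latticeMomentum L q i) * Real.cos (latticeMomentum L q j) =
      if i = j then (L : ℝ) ^ d / 2 else 0 := by
  haveI : Fact (1 < L) := ⟨by omega⟩
  have hne : (Pi.single i (1 : ZMod L) : TorusSite d L) + Pi.single j 1 ≠ 0 := by
    intro h
    have h' := congrFun h i
    rw [Pi.add_apply, Pi.single_eq_same, Pi.zero_apply] at h'
    by_cases hij : i = j
    · subst hij
      rw [Pi.single_eq_same, show (1 : ZMod L) + 1 = ((2 : ℕ) : ZMod L) by norm_num,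
        ZMod.natCast_eq_zero_iff] at h'
      exact absurd (Nat.le_of_dvd two_pos h') (by omega)
    · rw [Pi.single_eq_of_ne hij, add_zero] at h'
      exact one_ne_zero h'
  have hsub : (Pi.single i (1 : ZMod L) : TorusSite d L) - Pi.single j 1 = 0 ↔ i = j := by
    constructor
    · intro h
      by_contra hij
      have h' := congrFun h i
      rw [Pi.sub_apply, Pi.single_eq_same, Pi.single_eq_of_ne hij, sub_zero, Pi.zero_apply] at h'
      exact one_ne_zero h'
    · rintro rfl
      exact sub_self _
  calc ∑ q : TorusSite d L, Real.cos (latticeMomentum L q i) * Real.cos (latticeMomentum L q j)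
      = ∑ q : TorusSite d L, (Real.cos (torusPhase L q (Pi.single i 1 + Pi.single j 1)) +
          Real.cos (torusPhase L q (Pi.single i 1 - Pi.single j 1))) / 2 :=
        sum_congr rfl fun q _ => by
          rw [← cos_torusPhase_single L q i, cos_torusPhase_mul_cos_latticeMomentum]
    _ = ((if (Pi.single i (1 : ZMod L) : TorusSite d L) + Pi.single j 1 = 0 then (L : ℝ) ^ d
          else 0) + (if (Pi.single i (1 : ZMod L) : TorusSite d L) - Pi.single j 1 = 0
          then (L : ℝ) ^ d else 0)) / 2 := by
        rw [← sum_div, sum_add_distrib, sum_cos_torusPhase, sum_cos_torusPhase]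
    _ = _ := by
        rw [if_neg hne]
        by_cases hij : i = j
        · rw [if_pos (hsub.2 hij), if_pos hij]; ring
        · rw [if_neg (mt hsub.1 hij), if_neg hij]; ring

/-- `Σ_q C_K(q)² = ½|Λ| Σᵢ Kᵢ²` (`L ≥ 3`). [cite: KLS1988PRL, eq. (6)] -/
theorem sum_anisoCosSum_sq (hL3 : 3 ≤ L) (K : Fin d → ℝ) :
    ∑ q : TorusSite d L, anisoCosSum K (latticeMomentum L q) ^ 2 =
      (L : ℝ) ^ d / 2 * ∑ i, K i ^ 2 := by
  calc ∑ q : TorusSite d L, anisoCosSum K (latticeMomentum L q) ^ 2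
      = ∑ q : TorusSite d L, ∑ i, ∑ j, (K i * K j) *
          (Real.cos (latticeMomentum L q i) * Real.cos (latticeMomentum L q j)) := by
        refine sum_congr rfl fun q _ => ?_
        rw [anisoCosSum, sq, sum_mul_sum]
        exact sum_congr rfl fun i _ => sum_congr rfl fun j _ => by ring
    _ = ∑ i, ∑ j, (K i * K j) * ∑ q : TorusSite d L,
          Real.cos (latticeMomentum L q i) * Real.cos (latticeMomentum L q j) := by
        rw [sum_comm]
        refine sum_congr rfl fun i _ => ?_
        rw [sum_comm]
        refine sum_congr rfl fun j _ => ?_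
        rw [mul_sum]
    _ = ∑ i, ∑ j, (K i * K j) * (if i = j then (L : ℝ) ^ d / 2 else 0) := by
        simp_rw [sum_cos_mul_cos_latticeMomentum L hL3]
    _ = (L : ℝ) ^ d / 2 * ∑ i, K i ^ 2 := by
        simp_rw [mul_ite, mul_zero, Finset.sum_ite_eq, if_pos (mem_univ _)]
        rw [mul_sum]
        exact sum_congr rfl fun i _ => by ring

end TrigSums

/-! ### The half-period shift on an even torus flips every cosine -/

section HalfPeriod

/-- On the torus of even side `2k` (`k ≥ 1`), shifting a dual momentum index by `(k, …, k)` flips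
the sign of every `cos qᵢ`. [folklore] -/
private theorem cos_latticeMomentum_add_half (k : ℕ) (hk : 1 ≤ k) [NeZero (2 * k)]
    (q : TorusSite d (2 * k)) (i : Fin d) :
    Real.cos (latticeMomentum (2 * k) (q + fun _ => (k : ZMod (2 * k))) i) =
      -Real.cos (latticeMomentum (2 * k) q i) := by
  rw [latticeMomentum_apply, latticeMomentum_apply, Pi.add_apply, ZMod.val_add, ZMod.val_natCast,
    Nat.mod_eq_of_lt (show k < 2 * k by omega)]
  set a : ℕ := (q i).val with ha
  have hdiv := Nat.mod_add_div (a + k) (2 * k)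
  have hcast : (((a + k) % (2 * k) : ℕ) : ℝ) =
      (a : ℝ) + k - ((2 * k : ℕ) : ℝ) * (((a + k) / (2 * k) : ℕ) : ℝ) := by
    have h : (((a + k) % (2 * k) : ℕ) : ℝ) + ((2 * k : ℕ) : ℝ) * (((a + k) / (2 * k) : ℕ) : ℝ) =
        (a : ℝ) + k := by exact_mod_cast hdiv
    linarith
  rw [hcast]
  have hk0 : ((2 * k : ℕ) : ℝ) ≠ 0 := by exact_mod_cast (by omega : 2 * k ≠ 0)
  have h2k : ((2 * k : ℕ) : ℝ) = 2 * (k : ℝ) := by push_cast; ring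
  rw [show 2 * Real.pi * ((a : ℝ) + k - ((2 * k : ℕ) : ℝ) * (((a + k) / (2 * k) : ℕ) : ℝ)) /
      ((2 * k : ℕ) : ℝ) = 2 * Real.pi * (a : ℝ) / ((2 * k : ℕ) : ℝ) + Real.pi -
        (((a + k) / (2 * k) : ℕ) : ℝ) * (2 * Real.pi) by
      rw [h2k] at hk0 ⊢; field_simp,
    Real.cos_sub_nat_mul_two_pi, Real.cos_add_pi]

/-- Hence `C_K(q + (k,…,k)) = -C_K(q)`. [folklore] -/
private theorem anisoCosSum_latticeMomentum_add_half (k : ℕ) (hk : 1 ≤ k) [NeZero (2 * k)]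
    (K : Fin d → ℝ) (q : TorusSite d (2 * k)) :
    anisoCosSum K (latticeMomentum (2 * k) (q + fun _ => (k : ZMod (2 * k)))) =
      -anisoCosSum K (latticeMomentum (2 * k) q) := by
  simp only [anisoCosSum, cos_latticeMomentum_add_half k hk, mul_neg, sum_neg_distrib]

/-- **`Σ_q {C_K(q)}₊² = ¼|Λ| Σᵢ Kᵢ²` on the torus of even side `2k ≥ 4`** (the half-period shift
pairs `{C}₊²` with `{-C}₊²`, and `{x}₊² + {-x}₊² = x²`). [cite: KLS1988PRL, eq. (6)] -/
theorem sum_posPart_anisoCosSum_sq (k : ℕ) (hk : 2 ≤ k) [NeZero (2 * k)] (K : Fin d → ℝ) :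
    ∑ q : TorusSite d (2 * k), max (anisoCosSum K (latticeMomentum (2 * k) q)) 0 ^ 2 =
      ((2 * k : ℕ) : ℝ) ^ d / 4 * ∑ i, K i ^ 2 := by
  set h : TorusSite d (2 * k) := fun _ => (k : ZMod (2 * k)) with hh
  have hshift : ∑ q : TorusSite d (2 * k), max (anisoCosSum K (latticeMomentum (2 * k) q)) 0 ^ 2 =
      ∑ q : TorusSite d (2 * k), max (-anisoCosSum K (latticeMomentum (2 * k) q)) 0 ^ 2 := by
    rw [← Equiv.sum_comp (Equiv.addRight h)
      (fun q => max (anisoCosSum K (latticeMomentum (2 * k) q)) 0 ^ 2)]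
    refine sum_congr rfl fun q _ => ?_
    simp only [Equiv.coe_addRight, hh]
    rw [anisoCosSum_latticeMomentum_add_half k (by omega)]
  have hpm : ∀ x : ℝ, max x 0 ^ 2 + max (-x) 0 ^ 2 = x ^ 2 := fun x => by
    rcases le_or_gt 0 x with hx | hx
    · rw [max_eq_left hx, max_eq_right (by linarith), zero_pow two_ne_zero, add_zero]
    · rw [max_eq_right hx.le, max_eq_left (by linarith), zero_pow two_ne_zero, zero_add, neg_sq]
  have h2 : 2 * ∑ q : TorusSite d (2 * k), max (anisoCosSum K (latticeMomentum (2 * k) q)) 0 ^ 2 =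
      ∑ q : TorusSite d (2 * k), anisoCosSum K (latticeMomentum (2 * k) q) ^ 2 := by
    rw [two_mul]
    nth_rw 2 [hshift]
    rw [← sum_add_distrib]
    exact sum_congr rfl fun q _ => hpm _
  rw [sum_anisoCosSum_sq (2 * k) (by omega) K] at h2
  linarith

end HalfPeriod

/-! ### Cauchy–Schwarz -/

section CauchySchwarz

/-- **`R^K_L ≤ [Σᵢ Kᵢ² · T^K_L/(2κ_K)]^{1/2}`** on the torus of even side `L = 2k ≥ 4` (`K > 0`,
`d ≥ 1`), with the anisotropic torus sum `T^K_L = |Λ|⁻¹Σ_{q≠0} 1/E^K_q`: Cauchy–Schwarz in `q`,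
`Σ_{q≠0}{C_K}₊² ≤ ¼|Λ|Σᵢ Kᵢ²` (`sum_posPart_anisoCosSum_sq`). [cite: KLS1988PRL, eqs. (7)–(8)]
[cite: FILS1978, (4.7)] -/
theorem anisoKlsRiemannSum_le_sqrt (hd : 1 ≤ d) (k : ℕ) (hk : 2 ≤ k) [NeZero (2 * k)]
    {K : Fin d → ℝ} (hK : ∀ i, 0 < K i) :
    anisoKlsRiemannSum K (2 * k) ≤ Real.sqrt ((∑ i, K i ^ 2) / (2 * ∑ i, K i) *
      (1 / ((2 * k : ℕ) : ℝ) ^ d * ∑ q ∈ (univ : Finset (TorusSite d (2 * k))).erase 0,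
        1 / NVectorAniso.anisoDispersion K (latticeMomentum (2 * k) q))) := by
  set N : ℝ := ((2 * k : ℕ) : ℝ) ^ d with hN_def
  have hN : 0 < N := by rw [hN_def]; positivity
  set κ : ℝ := ∑ i, K i with hκ_def
  have hκ : 0 < κ := by
    obtain ⟨i⟩ : Nonempty (Fin d) := ⟨⟨0, hd⟩⟩
    exact lt_of_lt_of_le (hK i) (single_le_sum (fun j _ => (hK j).le) (mem_univ i))
  set s := (univ : Finset (TorusSite d (2 * k))).erase 0 with hs
  set a : TorusSite d (2 * k) → ℝ := fun q => max (anisoCosSum K (latticeMomentum (2 * k) q)) 0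
    with ha
  set b : TorusSite d (2 * k) → ℝ := fun q =>
    Real.sqrt (2 / (κ * NVectorAniso.anisoDispersion K (latticeMomentum (2 * k) q))) with hb
  set S : ℝ := ∑ q ∈ s, 1 / NVectorAniso.anisoDispersion K (latticeMomentum (2 * k) q) with hS
  have hR : anisoKlsRiemannSum K (2 * k) = (∑ q ∈ s, a q * b q) / N := by
    rw [anisoKlsRiemannSum_of_neZero]
    rfl
  have hR0 : 0 ≤ anisoKlsRiemannSum K (2 * k) := anisoKlsRiemannSum_nonneg K _
  -- the two square sums
  have ha2 : ∑ q ∈ s, a q ^ 2 ≤ N / 4 * ∑ i, K i ^ 2 := by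
    calc ∑ q ∈ s, a q ^ 2 ≤ ∑ q : TorusSite d (2 * k), a q ^ 2 :=
          sum_le_sum_of_subset_of_nonneg (erase_subset _ _) fun q _ _ => sq_nonneg _
      _ = N / 4 * ∑ i, K i ^ 2 := by rw [ha, hN_def]; exact sum_posPart_anisoCosSum_sq k hk K
  have hb2 : ∑ q ∈ s, b q ^ 2 = 2 / κ * S := by
    rw [hS, mul_sum]
    refine sum_congr rfl fun q hq => ?_
    have hE : 0 < NVectorAniso.anisoDispersion K (latticeMomentum (2 * k) q) :=
      anisoDispersion_latticeMomentum_pos (2 * k) hK (mem_erase.1 hq).1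
    rw [hb, Real.sq_sqrt (by positivity)]
    field_simp
  have hS0 : 0 ≤ S := sum_nonneg fun q hq =>
    div_nonneg zero_le_one (anisoDispersion_latticeMomentum_pos (2 * k) hK (mem_erase.1 hq).1).le
  -- Cauchy–Schwarz, squared
  have hsq : anisoKlsRiemannSum K (2 * k) ^ 2 ≤ (∑ i, K i ^ 2) / (2 * κ) * (1 / N * S) := by
    calc anisoKlsRiemannSum K (2 * k) ^ 2 = (∑ q ∈ s, a q * b q) ^ 2 / N ^ 2 := by
          rw [hR, div_pow]
      _ ≤ (N / 4 * ∑ i, K i ^ 2) * (2 / κ * S) / N ^ 2 := by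
          refine div_le_div_of_nonneg_right ((sum_mul_sq_le_sq_mul_sq s a b).trans ?_)
            (by positivity)
          rw [← hb2]
          exact mul_le_mul_of_nonneg_right ha2 (sum_nonneg fun _ _ => sq_nonneg _)
      _ = (∑ i, K i ^ 2) / (2 * κ) * (1 / N * S) := by
          field_simp
          ring
  exact Real.le_sqrt_of_sq_le hsq

end CauchySchwarz

/-! ### Long-range order from the infrared constant `C₀(K)` (`d ≥ 3`) -/

section InfraredConstant

/-- **The eventual bound on `R^K`.** In `d ≥ 3`, for `K > 0` and spin `n/2`: if
`Σᵢ Kᵢ² · C₀(K) < n² κ_K` (`C₀(K) = (2π)^{-d}∫dp/E^K_p`, `AnisotropicRotator.infraredConstant`),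
there is `ρ < n√2/2` with `R^K_{2k} ≤ ρ` for all large `k` (Cauchy–Schwarz and `T^K_L → C₀(K)`
along the even sides). [cite: FILS1978, (4.7)–(4.10)] [cite: KLS1988PRL, eq. (8)] -/
theorem anisoKlsRiemannSum_eventually_le_of_infraredConstant (hd3 : 3 ≤ d) {K : Fin d → ℝ}
    (hK : ∀ i, 0 < K i) {n : ℕ}
    (hC : (∑ i, K i ^ 2) * AnisotropicRotator.infraredConstant K < (n : ℝ) ^ 2 * ∑ i, K i) :
    ∃ ρ : ℝ, ρ < n * Real.sqrt 2 / 2 ∧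
      ∀ᶠ k : ℕ in atTop, anisoKlsRiemannSum K (2 * k) ≤ ρ := by
  have hd : 1 ≤ d := by omega
  set κ : ℝ := ∑ i, K i with hκ_def
  set A : ℝ := ∑ i, K i ^ 2 with hA_def
  set C₀ : ℝ := AnisotropicRotator.infraredConstant K with hC₀_def
  have hκ : 0 < κ := by
    obtain ⟨i⟩ : Nonempty (Fin d) := ⟨⟨0, hd⟩⟩
    exact lt_of_lt_of_le (hK i) (single_le_sum (fun j _ => (hK j).le) (mem_univ i))
  have hA : 0 < A := by
    obtain ⟨i⟩ : Nonempty (Fin d) := ⟨⟨0, hd⟩⟩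
    exact lt_of_lt_of_le (pow_pos (hK i) 2)
      (single_le_sum (fun j _ => sq_nonneg (K j)) (mem_univ i))
  -- since `n² κ - A C₀ > 0`, some `ε > 0` keeps `A (C₀ + ε) < n² κ`; `n > 0` follows
  have hn : (0 : ℝ) < n := by
    have h0 : 0 ≤ A * C₀ := by
      refine mul_nonneg hA.le ?_
      rw [hC₀_def, AnisotropicRotator.infraredConstant]
      refine mul_nonneg (by positivity)
        (setIntegral_nonneg (measurableSet_brillouin d) fun p _ => ?_)
      exact div_nonneg zero_le_one (le_trans (by positivity : (0:ℝ) ≤ 0)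
        (sum_nonneg fun i _ => mul_nonneg (hK i).le (sub_nonneg.2 (Real.cos_le_one _))))
    have : (0 : ℝ) < (n : ℝ) ^ 2 := by nlinarith
    exact_mod_cast Nat.pos_of_ne_zero fun h => by simp [h] at this
  set ε : ℝ := ((n : ℝ) ^ 2 * κ - A * C₀) / (2 * A) with hε_def
  have hε : 0 < ε := div_pos (by linarith) (by positivity)
  have hAε : A * (C₀ + ε) < (n : ℝ) ^ 2 * κ := by
    have : A * ε = ((n : ℝ) ^ 2 * κ - A * C₀) / 2 := by rw [hε_def]; field_simp
    nlinarith
  set ρ : ℝ := Real.sqrt (A / (2 * κ) * (C₀ + ε)) with hρ_def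
  refine ⟨ρ, ?_, ?_⟩
  · rw [hρ_def, Real.sqrt_lt' (by positivity)]
    rw [show ((n : ℝ) * Real.sqrt 2 / 2) ^ 2 = (n : ℝ) ^ 2 / 2 by
      rw [div_pow, mul_pow, Real.sq_sqrt (by norm_num)]; ring]
    rw [div_mul_eq_mul_div, div_lt_div_iff₀ (by positivity) (by norm_num)]
    nlinarith
  · -- the smallest coupling and the convergence of the torus sums
    obtain ⟨i₀, -, hi₀⟩ := exists_min_image univ K ⟨⟨0, by omega⟩, mem_univ _⟩
    have hm : 0 < K i₀ := hK i₀
    have hmK : ∀ i, K i₀ ≤ K i := fun i => hi₀ i (mem_univ i)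
    obtain ⟨L₀, hL₀⟩ := AnisotropicRotator.torusSum_inv_anisoDispersion_approx hd3 hm hmK hε
    filter_upwards [eventually_ge_atTop (L₀ + 2)] with k hk
    haveI : NeZero (2 * k) := ⟨by omega⟩
    have hT := hL₀ (2 * k) (even_two_mul k) (by omega)
    rw [abs_le] at hT
    refine (anisoKlsRiemannSum_le_sqrt hd k (by omega) hK).trans ?_
    rw [hρ_def]
    refine Real.sqrt_le_sqrt (mul_le_mul_of_nonneg_left ?_ (by positivity))
    linarith [hT.2]

/-- **Ground-state long-range order from the infrared constant** (`d ≥ 3`, `K > 0`, `S = n/2 ≥ ½`):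
if `Σᵢ Kᵢ² · C₀(K) < n² κ_K` then the tracial ground states of `H_K` on the even tori have
long-range order. [cite: KLS1988PRL, Theorem, eq. (8)] [cite: KLS1988JSP, §3]
[cite: FILS1978, (4.7)–(4.10)] -/
theorem xyAniso_longRangeOrder_ground_of_infraredConstant (hd3 : 3 ≤ d) {K : Fin d → ℝ}
    (hK : ∀ i, 0 < K i) {n : ℕ} (hn : 1 ≤ n)
    (hC : (∑ i, K i ^ 2) * AnisotropicRotator.infraredConstant K < (n : ℝ) ^ 2 * ∑ i, K i) :
    HasEvenTorusLRO
      (fun L x y => xyAnisoGroundCorr 0 L n K x y + xyAnisoGroundCorr 1 L n K x y) := by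
  obtain ⟨ρ, hρ, hR⟩ := anisoKlsRiemannSum_eventually_le_of_infraredConstant hd3 hK hC
  exact (xyAniso_longRangeOrder_ground_even (by omega) hK hn hρ hR).1

/-- **Low-temperature long-range order from the infrared constant** (`d ≥ 3`, `K > 0`,
`S = n/2 ≥ ½`): if `Σᵢ Kᵢ² · C₀(K) < n² κ_K` there is `β₀ > 0` such that for every `β ≥ β₀` the
Gibbs states of `H_K` on the even tori have long-range order.
[cite: DysonLiebSimon1978, Thms. 5.1, 5.2] [cite: KLS1988JSP, p. 1020]
[cite: FILS1978, (4.7)–(4.10)] -/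
theorem xyAniso_longRangeOrder_thermal_of_infraredConstant (hd3 : 3 ≤ d) {K : Fin d → ℝ}
    (hK : ∀ i, 0 < K i) {n : ℕ} (hn : 1 ≤ n)
    (hC : (∑ i, K i ^ 2) * AnisotropicRotator.infraredConstant K < (n : ℝ) ^ 2 * ∑ i, K i) :
    ∃ β₀ : ℝ, 0 < β₀ ∧ ∀ β : ℝ, β₀ ≤ β →
      HasEvenTorusLRO (fun L x y => xyAnisoThermalCorr β K L n x y) := by
  have hd : 1 ≤ d := by omega
  obtain ⟨ρ, hρ, hR⟩ := anisoKlsRiemannSum_eventually_le_of_infraredConstant hd3 hK hC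
  obtain ⟨i₀, -, hi₀⟩ := exists_min_image univ K ⟨⟨0, by omega⟩, mem_univ _⟩
  have hm : 0 < K i₀ := hK i₀
  have hmK : ∀ i, K i₀ ≤ K i := fun i => hi₀ i (mem_univ i)
  obtain ⟨𝒯, k₀, h𝒯0, h𝒯⟩ := torusGreen_zero_eventually_le (d := d) hd3
  have hJ : ∀ᶠ k : ℕ in atTop, anisoKlsThermalSum K (2 * k) ≤ 𝒯 / K i₀ := by
    filter_upwards [eventually_ge_atTop k₀, eventually_ge_atTop 1] with k hk hk1
    haveI : NeZero (2 * k) := ⟨by omega⟩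
    exact (anisoKlsThermalSum_le_torusGreen_div hd (2 * k) hm hmK).trans
      (div_le_div_of_nonneg_right (h𝒯 k hk hk1) hm.le)
  exact xyAniso_longRangeOrder_thermal_even hd hK hn hρ (div_nonneg h𝒯0 hm.le) hR hJ

end InfraredConstant

/-! ### The layered model `K = (1, 1, r)` -/

section Layered

open AnisotropicRotator in
/-- The couplings `(1, 1, r)`: `Σᵢ Kᵢ = 2 + r`, `Σᵢ Kᵢ² = 2 + r²`, and `C₀ = C(r)`.
[cite: KLS1988JSP, eqs. (5), (7)] -/
theorem layeredCoupling_one_sums (r : ℝ) :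
    (∑ i, layeredCoupling 1 r i) = 2 + r ∧ (∑ i, layeredCoupling 1 r i ^ 2) = 2 + r ^ 2 ∧
      infraredConstant (layeredCoupling 1 r) = klsConstant r := by
  have h0 : layeredCoupling 1 r 0 = 1 := if_neg (by decide)
  have h1 : layeredCoupling 1 r 1 = 1 := if_neg (by decide)
  have h2 : layeredCoupling 1 r 2 = r := if_pos rfl
  refine ⟨?_, ?_, ?_⟩
  · rw [Fin.sum_univ_three, h0, h1, h2]; ring
  · rw [Fin.sum_univ_three, h0, h1, h2]; ring
  · rw [infraredConstant_layeredCoupling one_ne_zero, div_one, div_one]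

open AnisotropicRotator in
/-- **Long-range order in the layered quantum XY / hard-core-boson model from `C(r)`**
([KLS1988JSP] §3 with p. 1020, XY version): for `r > 0` and spin `S = n/2 ≥ ½`, if
`(2 + r²) C(r) < n²(2 + r)` (`C(r) = (2π)⁻³∫d³q/E^r_q`), then the ground states of
`H = -Σ_x[Σ_{i=1,2}(S¹_xS¹_{x+eᵢ} + S²_xS²_{x+eᵢ}) + r(S¹_xS¹_{x+e₃} + S²_xS²_{x+e₃})]` on the even
tori `(ℤ/2kℤ)³` have long-range order, and so do the Gibbs states for `β ≥ β₀` (some `β₀ > 0`). For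
`S = ½` the hypothesis is `(2 + r²)C(r) < 2 + r` (e.g. `C(1) = 0.505…`, Watson's integral).
[cite: KLS1988JSP, §3 and p. 1020] [cite: KLS1988PRL, Theorem] [cite: DysonLiebSimon1978, Thm. 5.2]
[cite: FILS1978, (4.7)–(4.10)] -/
theorem xyLayered_longRangeOrder_of_klsConstant {r : ℝ} (hr : 0 < r) {n : ℕ} (hn : 1 ≤ n)
    (hC : (2 + r ^ 2) * klsConstant r < (n : ℝ) ^ 2 * (2 + r)) :
    HasEvenTorusLRO (fun L x y => xyAnisoGroundCorr 0 L n (layeredCoupling 1 r) x y +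
        xyAnisoGroundCorr 1 L n (layeredCoupling 1 r) x y) ∧
      ∃ β₀ : ℝ, 0 < β₀ ∧ ∀ β : ℝ, β₀ ≤ β →
        HasEvenTorusLRO (fun L x y => xyAnisoThermalCorr β (layeredCoupling 1 r) L n x y) := by
  have hK : ∀ i, 0 < layeredCoupling 1 r i := fun i => by
    unfold layeredCoupling; split_ifs; exacts [hr, one_pos]
  obtain ⟨hs1, hs2, hc⟩ := layeredCoupling_one_sums r
  have hC' : (∑ i, layeredCoupling 1 r i ^ 2) * infraredConstant (layeredCoupling 1 r) <
      (n : ℝ) ^ 2 * ∑ i, layeredCoupling 1 r i := by rw [hs1, hs2, hc]; exact hC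
  exact ⟨xyAniso_longRangeOrder_ground_of_infraredConstant le_rfl hK hn hC',
    xyAniso_longRangeOrder_thermal_of_infraredConstant le_rfl hK hn hC'⟩

/-- `log 100 ≤ 5`. [folklore] -/
private theorem log_hundred_le_five : Real.log 100 ≤ 5 := by
  rw [Real.log_le_iff_le_exp (by norm_num)]
  have h1 : (2.7182818283 : ℝ) < Real.exp 1 := Real.exp_one_gt_d9
  have h5 : Real.exp 5 = Real.exp 1 ^ 5 := by rw [← Real.exp_nat_mul]; norm_num
  rw [h5]
  have h2 : (2.7182818283 : ℝ) ^ 5 ≤ Real.exp 1 ^ 5 :=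
    pow_le_pow_left₀ (by norm_num) h1.le 5
  nlinarith

open AnisotropicRotator in
/-- **Unconditional long-range order of the layered quantum XY model for spin `S ≥ 1`**: for
`S = n/2` with `n ≥ 2` and interlayer coupling `1/100 ≤ r ≤ 1`, the ground states of the layered
model on the even tori `(ℤ/2kℤ)³` have long-range order, and there is `β₀ > 0` such that the Gibbs
states have long-range order for every `β ≥ β₀` — from `xyLayered_longRangeOrder_of_klsConstant` and
the tree's bound `C(r) ≤ 1 + π/4 + (π/8)log(1/r)` (`klsConstant_le_sharp`):
`(2 + r²)C(r) ≤ (2 + r)(1 + 7π/8) < 4(2 + r) ≤ n²(2 + r)`. (Kennedy–Lieb–Shastry's layered model,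
[KLS1988JSP] §3 "for 1 ≥ r ≥ 0.16" in the antiferromagnet; here the XY version, all `S ≥ 1`,
`r ≥ 1/100`, `T = 0` and `T > 0`.) [cite: KLS1988JSP, §3, Theorem and p. 1020]
[cite: KLS1988PRL, Theorem] [cite: DysonLiebSimon1978, Thm. 5.2] [cite: FILS1978, (4.7)–(4.10)] -/
theorem xyLayered_longRangeOrder_spin_ge_one {r : ℝ} (hr : 1 / 100 ≤ r) (hr1 : r ≤ 1) {n : ℕ}
    (hn : 2 ≤ n) :
    HasEvenTorusLRO (fun L x y => xyAnisoGroundCorr 0 L n (layeredCoupling 1 r) x y +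
        xyAnisoGroundCorr 1 L n (layeredCoupling 1 r) x y) ∧
      ∃ β₀ : ℝ, 0 < β₀ ∧ ∀ β : ℝ, β₀ ≤ β →
        HasEvenTorusLRO (fun L x y => xyAnisoThermalCorr β (layeredCoupling 1 r) L n x y) := by
  have hr0 : 0 < r := lt_of_lt_of_le (by norm_num) hr
  refine xyLayered_longRangeOrder_of_klsConstant hr0 (by omega) ?_
  have hCle := klsConstant_le_sharp hr0 hr1
  -- `log(1/r) ≤ log 100 ≤ 5`
  have hlog : Real.log (1 / r) ≤ 5 := by
    refine le_trans (Real.log_le_log (by positivity) ?_) log_hundred_le_five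
    rw [div_le_iff₀ hr0]
    linarith
  have hπ := Real.pi_lt_d2
  have hπ0 := Real.pi_pos
  have hB : AnisotropicRotator.klsConstant r < 4 := by
    have : Real.pi / 8 * Real.log (1 / r) ≤ Real.pi / 8 * 5 :=
      mul_le_mul_of_nonneg_left hlog (by positivity)
    linarith
  have hn2 : (2 : ℝ) ≤ n := by exact_mod_cast hn
  have hn4 : (4 : ℝ) ≤ (n : ℝ) ^ 2 := by nlinarith
  have hr2 : r ^ 2 ≤ r := by nlinarith
  -- `(2 + r²) C ≤ (2 + r) C < 4 (2 + r) ≤ n² (2 + r)` (`C < 4`; trivial if `C < 0`)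
  rcases le_or_gt 0 (AnisotropicRotator.klsConstant r) with hC0 | hC0
  · calc (2 + r ^ 2) * klsConstant r ≤ (2 + r) * klsConstant r :=
          mul_le_mul_of_nonneg_right (by linarith) hC0
      _ < (2 + r) * 4 := mul_lt_mul_of_pos_left hB (by linarith)
      _ ≤ (n : ℝ) ^ 2 * (2 + r) := by nlinarith
  · calc (2 + r ^ 2) * klsConstant r < 0 := mul_neg_of_pos_of_neg (by positivity) hC0
      _ ≤ (n : ℝ) ^ 2 * (2 + r) := by positivity

open AnisotropicRotator in
/-- **Long-range order in the layered hard-core-boson / quantum XY model for `½ ≤ r ≤ 1` and every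
spin `S ≥ ½`, conditional only on Watson's integral `latticeGreen 0 ≤ 13/25`** (true value
`0.5054…`; this enclosure is certified in the tree on the summit side,
`Summits/CriticalPhenomena/…/latticeGreen_zero_le`, which a Literature file may not import, so it
enters here as the hypothesis `hG`): by `C(r) ≤ latticeGreen 0 / r`
(`klsConstant_le_latticeGreen_div`) and `(2 + r²)(13/25) < r(2 + r)` on `[½, 1]`,
`xyLayered_longRangeOrder_of_klsConstant` applies with `n = 1`. [cite: KLS1988JSP, §3 and p. 1020] [cite: KLS1988PRL, Theorem]
[cite: DysonLiebSimon1978, Thm. 5.2] [cite: FILS1978, (4.7)–(4.10)] -/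
theorem xyLayered_longRangeOrder_of_latticeGreen_le {r : ℝ} (hr : 1 / 2 ≤ r) (hr1 : r ≤ 1)
    {n : ℕ} (hn : 1 ≤ n) (hG : latticeGreen (0 : Site 3) ≤ 13 / 25) :
    HasEvenTorusLRO (fun L x y => xyAnisoGroundCorr 0 L n (layeredCoupling 1 r) x y +
        xyAnisoGroundCorr 1 L n (layeredCoupling 1 r) x y) ∧
      ∃ β₀ : ℝ, 0 < β₀ ∧ ∀ β : ℝ, β₀ ≤ β →
        HasEvenTorusLRO (fun L x y => xyAnisoThermalCorr β (layeredCoupling 1 r) L n x y) := by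
  have hr0 : 0 < r := lt_of_lt_of_le (by norm_num) hr
  refine xyLayered_longRangeOrder_of_klsConstant hr0 hn ?_
  have hC : klsConstant r ≤ 13 / 25 / r :=
    (klsConstant_le_latticeGreen_div hr0 hr1).trans (div_le_div_of_nonneg_right hG hr0.le)
  have hn1 : (1 : ℝ) ≤ (n : ℝ) ^ 2 := by
    have : (1 : ℝ) ≤ n := by exact_mod_cast hn
    nlinarith
  have hkey : (2 + r ^ 2) * (13 / 25 / r) < 2 + r := by
    rw [mul_div_assoc', div_lt_iff₀ hr0]
    nlinarith
  calc (2 + r ^ 2) * klsConstant r ≤ (2 + r ^ 2) * (13 / 25 / r) :=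
        mul_le_mul_of_nonneg_left hC (by positivity)
    _ < 2 + r := hkey
    _ ≤ (n : ℝ) ^ 2 * (2 + r) := by nlinarith

end Layered

end Literature.MathematicalPhysics.QuantumLattice
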